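import Summits.QuantumFields.QCD.Theses.QuarksAsStableAction
import Literature.MathematicalPhysics.QuantumLattice.WilsonDiracAP
import Summits.QuantumFields.QCD.Theorems.QuarksAsStableActionUnquenchedChessboardBoundStubAxisSwap

/-!
# Hypercubic covariance of the doubly static gain
(stub `stub_staticCovariance` of crux stmt-QuantumFields-9734, line `Sketch`, static route)

What.  The doubly static gain is first proved for statically lifted 2D fields
`A : ℤ/L → ℤ/L → Fin 4 → U(3)` at the gain orientation `(2,3)` (the antiperiodic `±1` pattern on
the `0,1`-links, the seam-signed `A (x 2) (x 3) j` on the `j`-links, `j = 2, 3`), with the gain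
measured by the `(2,3)`-plaquette deficits of `A`.  Here we transport it to the crux's `SU(3)`
field `U` at every orientation `μ < ν` and base point `y`: the doubly static field `W(μ,ν,y)[U]`
(antiperiodic lift of `U` on the `μ,ν`-links of the `(μ,ν)`-plane through `y`, antiperiodic
pattern on the other links) gains from the `(μ,ν)`-plaquettes of `U` in that plane.

How.
* `StaticCovariance.det_wilsonDirac_perm`: the Wilson determinant (`r = 1`, `U(3)` links) is
  invariant under the pull-back `(π • V)(x, j) = V(x ∘ π, π⁻¹ j)` of EVERY coordinate permutation
  `π` of the four-torus — the transpositions `(0 i)` are `AxisSwap.det_wilsonDirac_swap`, a general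
  transposition is `(a b) = (0 a)(0 b)(0 a)` (`det_wilsonDirac_swap_any`), and
  `Equiv.Perm.swap_induction_on` does the rest.
* `StaticCovariance.lift_plane_eq`: for a permutation with `π μ = 2`, `π ν = 3` the pull-back of
  `W(μ,ν,y)[U]` is literally the static lift of the 2D field `A a b j = U(site a b, π⁻¹ j)` read
  off the plane (`site a b = y[μ ↦ a, ν ↦ b]`).
* `StaticCovariance.dfc2_plane_eq`: the `(2,3)`-deficit of `A` at `(a, b)` is the deficit of the
  `(μ,ν)`-plaquette of `U` at `site a b` (`site (a+1) b`, `site a (b+1)` are its shifts;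
  `↑(g⁻¹) = (↑g)ᴴ` in `SU(3)`), and `(a, b) ↦ (site a b, (μ,ν))` is a bijection onto the plaquettes
  of the plane (`StaticCovariance.plane_reindex`), so the gain exponents agree.
* The permutation `π = (2 μ)(3 ν)` does it for every `μ < ν` (`StaticCovariance.swap_pair_apply`).
The plane sites `site` and the 2D field `A` are passed around as variables with their defining
equations (`hsite`, `hA`); no definitions are introduced.
Sources: folklore (hypercubic symmetry of Wilson fermions: I. Montvay, G. Münster, *Quantum Fields
on a Lattice* (CUP 1994), §4.2 and App. 8.1.2); Mathlib only beyond the tree.  Pure theorem file.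
-/

noncomputable section

open scoped BigOperators Matrix ComplexConjugate
open Finset
open Literature.MathematicalPhysics.QuantumLattice Literature.MathematicalPhysics.QuantumFieldTheory
  Literature.Probability.LatticeModels

namespace Summit.QuantumFields.QCD.Cruxes.CriticalLineDiamagnetism.ChessboardCellGain

namespace StaticCovariance

open Summit.QuantumFields.QCD.Theorems.UnquenchedChessboardBoundLine

variable {L : ℕ}

/-! ### Coordinate permutations and the Wilson determinant -/

/-- Every transposition `(a b)` of the axes, acting by the pull-back `V ↦ (x, j) ↦ V(x ∘ (a b), (a b) j)`,
leaves the Wilson determinant invariant: `(0 i)` is `AxisSwap.det_wilsonDirac_swap`, and for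
`a, b ≠ 0` one has `(a b) = (0 a)(0 b)(0 a)`, three such pull-backs in a row. -/
theorem det_wilsonDirac_swap_any [NeZero L] {a b : Fin 4} (hab : a ≠ b)
    (V : GaugeConfig 4 L (Matrix.unitaryGroup (Fin 3) ℂ)) (m : ℝ) :
    (wilsonDirac (unitaryFundamentalRep (Fin 3) ℂ)
        (fun e : Edge 4 L => V (e.1 ∘ ⇑(Equiv.swap a b), Equiv.swap a b e.2)) m 1).det =
      (wilsonDirac (unitaryFundamentalRep (Fin 3) ℂ) V m 1).det := by
  have hρ : ∀ g : Matrix.unitaryGroup (Fin 3) ℂ,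
      unitaryFundamentalRep (Fin 3) ℂ g ∈ Matrix.unitaryGroup (Fin 3) ℂ :=
    unitaryFundamentalRep_mem_unitaryGroup
  by_cases ha : a = 0
  · subst ha
    exact AxisSwap.det_wilsonDirac_swap _ hρ V b m
  by_cases hb : b = 0
  · subst hb
    rw [Equiv.swap_comm]
    exact AxisSwap.det_wilsonDirac_swap _ hρ V a m
  rw [← Equiv.swap_mul_swap_mul_swap hb (Ne.symm hab), Equiv.swap_comm b 0]
  have hF : (fun e : Edge 4 L =>
        V (e.1 ∘ ⇑(Equiv.swap 0 a * Equiv.swap 0 b * Equiv.swap 0 a),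
          (Equiv.swap 0 a * Equiv.swap 0 b * Equiv.swap 0 a) e.2)) =
      fun e : Edge 4 L =>
        (fun e' : Edge 4 L =>
          (fun e'' : Edge 4 L => V (e''.1 ∘ ⇑(Equiv.swap (0 : Fin 4) a), Equiv.swap (0 : Fin 4) a e''.2))
            (e'.1 ∘ ⇑(Equiv.swap (0 : Fin 4) b), Equiv.swap (0 : Fin 4) b e'.2))
          (e.1 ∘ ⇑(Equiv.swap (0 : Fin 4) a), Equiv.swap (0 : Fin 4) a e.2) := rfl
  rw [hF, AxisSwap.det_wilsonDirac_swap _ hρ (fun e' : Edge 4 L =>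
      (fun e'' : Edge 4 L => V (e''.1 ∘ ⇑(Equiv.swap (0 : Fin 4) a), Equiv.swap (0 : Fin 4) a e''.2))
        (e'.1 ∘ ⇑(Equiv.swap (0 : Fin 4) b), Equiv.swap (0 : Fin 4) b e'.2)) a m,
    AxisSwap.det_wilsonDirac_swap _ hρ
      (fun e'' : Edge 4 L => V (e''.1 ∘ ⇑(Equiv.swap (0 : Fin 4) a), Equiv.swap (0 : Fin 4) a e''.2)) b m,
    AxisSwap.det_wilsonDirac_swap _ hρ V a m]

/-- **Hypercubic covariance of the Wilson determinant under every coordinate permutation**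
(`r = 1`, `U(3)` links in the defining representation): the pull-back
`(π • V)(x, j) = V(x ∘ π, π⁻¹ j)` has the same determinant as `V`. -/
theorem det_wilsonDirac_perm [NeZero L] (π : Equiv.Perm (Fin 4))
    (V : GaugeConfig 4 L (Matrix.unitaryGroup (Fin 3) ℂ)) (m : ℝ) :
    (wilsonDirac (unitaryFundamentalRep (Fin 3) ℂ)
        (fun e : Edge 4 L => V (e.1 ∘ ⇑π, π.symm e.2)) m 1).det =
      (wilsonDirac (unitaryFundamentalRep (Fin 3) ℂ) V m 1).det := by
  induction π using Equiv.Perm.swap_induction_on generalizing V with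
  | one => rfl
  | swap_mul f a b hab ih =>
    have hF : (fun e : Edge 4 L => V (e.1 ∘ ⇑(Equiv.swap a b * f), (Equiv.swap a b * f).symm e.2)) =
        fun e : Edge 4 L => (fun e' : Edge 4 L => V (e'.1 ∘ ⇑f, f.symm e'.2))
          (e.1 ∘ ⇑(Equiv.swap a b), Equiv.swap a b e.2) := rfl
    rw [hF, det_wilsonDirac_swap_any hab (fun e' : Edge 4 L => V (e'.1 ∘ ⇑f, f.symm e'.2)) m]
    exact ih V

/-! ### The `(μ, ν)`-plane through a base point -/

variable {μ ν : Fin 4} {y : Site 4 L} {site : ZMod L → ZMod L → Site 4 L}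

/-- The `μ`-coordinate of the plane site `site a b = y[μ ↦ a, ν ↦ b]`. -/
theorem site_apply_fst (hsite : ∀ a b i, site a b i = if i = μ then a else if i = ν then b else y i)
    (a b : ZMod L) : site a b μ = a := by
  rw [hsite, if_pos rfl]

/-- The `ν`-coordinate of a plane site. -/
theorem site_apply_snd (hsite : ∀ a b i, site a b i = if i = μ then a else if i = ν then b else y i)
    (h : μ ≠ ν) (a b : ZMod L) : site a b ν = b := by
  rw [hsite, if_neg h.symm, if_pos rfl]

/-- The transverse coordinates of a plane site are those of the base point. -/
theorem site_apply_of_ne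
    (hsite : ∀ a b i, site a b i = if i = μ then a else if i = ν then b else y i) {i : Fin 4}
    (hiμ : i ≠ μ) (hiν : i ≠ ν) (a b : ZMod L) : site a b i = y i := by
  rw [hsite, if_neg hiμ, if_neg hiν]

/-- A site of the plane is the plane site of its `μ`- and `ν`-coordinates. -/
theorem site_eq (hsite : ∀ a b i, site a b i = if i = μ then a else if i = ν then b else y i)
    {x : Site 4 L} (hx : ∀ i, i ≠ μ → i ≠ ν → x i = y i) : site (x μ) (x ν) = x := by
  funext i
  rw [hsite]
  by_cases hiμ : i = μ
  · rw [if_pos hiμ, hiμ]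
  · rw [if_neg hiμ]
    by_cases hiν : i = ν
    · rw [if_pos hiν, hiν]
    · rw [if_neg hiν, hx i hiμ hiν]

/-- The `μ`-shift of a plane site. -/
theorem site_shift_fst
    (hsite : ∀ a b i, site a b i = if i = μ then a else if i = ν then b else y i) (a b : ZMod L) :
    (site a b).shift μ = site (a + 1) b := by
  funext i
  simp only [Literature.MathematicalPhysics.QuantumFieldTheory.Site.shift, Pi.add_apply, hsite,
    Pi.single_apply]
  by_cases hiμ : i = μ
  · simp [hiμ]
  · simp [hiμ]

/-- The `ν`-shift of a plane site. -/
theorem site_shift_snd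
    (hsite : ∀ a b i, site a b i = if i = μ then a else if i = ν then b else y i) (h : μ ≠ ν)
    (a b : ZMod L) : (site a b).shift ν = site a (b + 1) := by
  funext i
  simp only [Literature.MathematicalPhysics.QuantumFieldTheory.Site.shift, Pi.add_apply, hsite,
    Pi.single_apply]
  by_cases hiμ : i = μ
  · subst hiμ
    simp [h]
  · by_cases hiν : i = ν
    · subst hiν
      simp [hiμ]
    · simp [hiμ, hiν]

/-- **Reindexing the plaquettes of the plane** by their `μ`- and `ν`-coordinates: sums and counts
over the plaquettes `p` of the `(μ,ν)`-plane through `y` selected by a condition on `g p` are sums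
and counts over `ℤ/L × ℤ/L`, for `f (a, b) = g (site a b, (μ, ν))`. -/
theorem plane_reindex [NeZero L] (hμν : μ < ν)
    (hsite : ∀ a b i, site a b i = if i = μ then a else if i = ν then b else y i)
    (g : Plaquette 4 L → ℝ) (f : ZMod L × ZMod L → ℝ)
    (hfg : ∀ ab, f ab = g (site ab.1 ab.2, ⟨(μ, ν), hμν⟩)) (Q : ℝ → Prop)
    (s : Finset (Plaquette 4 L)) (t : Finset (ZMod L × ZMod L))
    (hs : ∀ p, p ∈ s ↔ (p.2.1.1 = μ ∧ p.2.1.2 = ν ∧ ∀ i, i ≠ μ → i ≠ ν → p.1 i = y i) ∧ Q (g p))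
    (ht : ∀ ab, ab ∈ t ↔ Q (f ab)) :
    ∑ p ∈ s, g p = ∑ ab ∈ t, f ab ∧ s.card = t.card := by
  have hne : μ ≠ ν := hμν.ne
  have hplaq : ∀ p ∈ s, ((site (p.1 μ) (p.1 ν), ⟨(μ, ν), hμν⟩) : Plaquette 4 L) = p := by
    intro p hp
    obtain ⟨⟨hpμ, hpν, hpy⟩, -⟩ := (hs p).1 hp
    exact Prod.ext (site_eq hsite hpy) (Subtype.ext (Prod.ext hpμ.symm hpν.symm))
  have hg : ∀ p ∈ s, g p = f (p.1 μ, p.1 ν) := fun p hp => by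
    rw [hfg]
    exact congrArg g (hplaq p hp).symm
  have hi : ∀ p ∈ s, (p.1 μ, p.1 ν) ∈ t := fun p hp =>
    (ht _).2 (hg p hp ▸ ((hs p).1 hp).2)
  have hj : ∀ ab ∈ t, ((site ab.1 ab.2, ⟨(μ, ν), hμν⟩) : Plaquette 4 L) ∈ s := fun ab hab =>
    (hs _).2 ⟨⟨rfl, rfl, fun i hiμ hiν => site_apply_of_ne hsite hiμ hiν ab.1 ab.2⟩,
      hfg ab ▸ (ht ab).1 hab⟩
  have hji : ∀ ab ∈ t, (site ab.1 ab.2 μ, site ab.1 ab.2 ν) = ab := fun ab _ =>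
    Prod.ext (site_apply_fst hsite ab.1 ab.2) (site_apply_snd hsite hne ab.1 ab.2)
  exact ⟨Finset.sum_bij' (fun p _ => (p.1 μ, p.1 ν))
      (fun ab _ => ((site ab.1 ab.2, ⟨(μ, ν), hμν⟩) : Plaquette 4 L)) hi hj hplaq hji hg,
    Finset.card_bij' (fun p _ => (p.1 μ, p.1 ν))
      (fun ab _ => ((site ab.1 ab.2, ⟨(μ, ν), hμν⟩) : Plaquette 4 L)) hi hj hplaq hji⟩

/-! ### The 2D field read off the plane -/

/-- The directions other than `0, 1` are `2, 3`. -/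
theorem fin4_eq_two_or_three : ∀ j : Fin 4, ¬(j = 0 ∨ j = 1) → j = 2 ∨ j = 3 := by decide

/-- **The static lift of the plane field is the pull-back of the doubly static field.**  For
`π μ = 2`, `π ν = 3`, the 2D field `A a b j = U(site a b, π⁻¹ j)` (included in `U(3)`) and the
doubly static field `W = W(μ,ν,y)[U]`, the static lift of `A` (antiperiodic pattern on the
`0,1`-links, seam-signed `A` on the `2,3`-links) is the pull-back `π • W`. -/
theorem lift_plane_eq (U : GaugeConfig 4 L (Matrix.specialUnitaryGroup (Fin 3) ℂ)) (hμν : μ < ν)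
    (π : Equiv.Perm (Fin 4)) (hπμ : π μ = 2) (hπν : π ν = 3)
    (hsite : ∀ a b i, site a b i = if i = μ then a else if i = ν then b else y i)
    {A : ZMod L → ZMod L → Fin 4 → Matrix.unitaryGroup (Fin 3) ℂ}
    (hA : ∀ a b j, A a b j = unitaryLift U (site a b, π.symm j))
    {W : GaugeConfig 4 L (Matrix.unitaryGroup (Fin 3) ℂ)}
    (hW : ∀ e, W e = if e.2 = μ ∨ e.2 = ν
      then apLift U (fun i => if i = μ ∨ i = ν then e.1 i else y i, e.2)
      else (if e.1 e.2 = -1 then (-1 : Matrix.unitaryGroup (Fin 3) ℂ) else 1)) :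
    (fun e : Edge 4 L =>
        if e.2 = 0 ∨ e.2 = 1 then (if e.1 e.2 = -1 then (-1 : Matrix.unitaryGroup (Fin 3) ℂ) else 1)
        else (if e.1 e.2 = -1 then -(A (e.1 2) (e.1 3) e.2) else A (e.1 2) (e.1 3) e.2)) =
      fun e : Edge 4 L => W (e.1 ∘ ⇑π, π.symm e.2) := by
  have hs2 : π.symm 2 = μ := by rw [← hπμ, Equiv.symm_apply_apply]
  have hs3 : π.symm 3 = ν := by rw [← hπν, Equiv.symm_apply_apply]
  funext ⟨x, j⟩
  rw [hW]
  simp only [Function.comp_apply, Equiv.apply_symm_apply]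
  by_cases hj : j = 0 ∨ j = 1
  · have hW : ¬(π.symm j = μ ∨ π.symm j = ν) := by
      rw [Equiv.symm_apply_eq, Equiv.symm_apply_eq, hπμ, hπν]
      rcases hj with rfl | rfl <;> decide
    rw [if_pos hj, if_neg hW]
  · have hj' : j = 2 ∨ j = 3 := fin4_eq_two_or_three j hj
    have hW : π.symm j = μ ∨ π.symm j = ν := by
      rw [Equiv.symm_apply_eq, Equiv.symm_apply_eq, hπμ, hπν]
      exact hj'
    have hsx : (fun i => if i = μ ∨ i = ν then x (π i) else y i) = site (x 2) (x 3) := by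
      funext i
      rw [hsite]
      by_cases hiμ : i = μ
      · subst hiμ
        simp [hπμ]
      · by_cases hiν : i = ν
        · subst hiν
          simp [hπν, hiμ]
        · simp [hiμ, hiν]
    have hsk : site (x 2) (x 3) (π.symm j) = x j := by
      rcases hj' with rfl | rfl
      · rw [hs2, site_apply_fst hsite]
      · rw [hs3, site_apply_snd hsite hμν.ne]
    rw [if_neg hj, if_pos hW, hsx, apLift_apply]
    simp only [hA, hsk]

/-- The inverse in `SU(3)` is the conjugate transpose on the underlying matrices. -/
theorem coe_inv_specialUnitary (g : Matrix.specialUnitaryGroup (Fin 3) ℂ) :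
    ((g⁻¹ : Matrix.specialUnitaryGroup (Fin 3) ℂ) : Matrix (Fin 3) (Fin 3) ℂ) =
      star (g : Matrix (Fin 3) (Fin 3) ℂ) := rfl

/-- **The `(2,3)`-deficits of the plane field are the `(μ,ν)`-deficits of `U` in the plane**:
`3 - Re tr (A_{ab,2} A_{(a+1)b,3} A_{a(b+1),2}ᴴ A_{ab,3}ᴴ) = 3 - Re tr U_p` for the plaquette
`p = (site a b, (μ,ν))`. -/
theorem dfc2_plane_eq (U : GaugeConfig 4 L (Matrix.specialUnitaryGroup (Fin 3) ℂ)) (hμν : μ < ν)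
    (π : Equiv.Perm (Fin 4)) (hπμ : π μ = 2) (hπν : π ν = 3)
    (hsite : ∀ a b i, site a b i = if i = μ then a else if i = ν then b else y i)
    {A : ZMod L → ZMod L → Fin 4 → Matrix.unitaryGroup (Fin 3) ℂ}
    (hA : ∀ a b j, A a b j = unitaryLift U (site a b, π.symm j)) (a b : ZMod L) :
    3 - ((A a b 2 : Matrix (Fin 3) (Fin 3) ℂ) * (A (a + 1) b 3 : Matrix (Fin 3) (Fin 3) ℂ) *
        star (A a (b + 1) 2 : Matrix (Fin 3) (Fin 3) ℂ) *
        star (A a b 3 : Matrix (Fin 3) (Fin 3) ℂ)).trace.re =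
      3 - (fundamentalRep (Fin 3) (plaquetteHolonomy U (site a b) μ ν)).trace.re := by
  have hs2 : π.symm 2 = μ := by rw [← hπμ, Equiv.symm_apply_apply]
  have hs3 : π.symm 3 = ν := by rw [← hπν, Equiv.symm_apply_apply]
  simp only [hA, hs2, hs3, fundamentalRep_apply, plaquetteHolonomy, site_shift_fst hsite,
    site_shift_snd hsite hμν.ne, Submonoid.coe_mul, coe_inv_specialUnitary, coe_unitaryLift_apply]

/-- The permutation `(2 μ)(3 ν)` sends `μ ↦ 2` and `ν ↦ 3` for `μ < ν`. -/
theorem swap_pair_apply (hμν : μ < ν) :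
    (Equiv.swap (2 : Fin 4) μ * Equiv.swap 3 ν) μ = 2 ∧
      (Equiv.swap (2 : Fin 4) μ * Equiv.swap 3 ν) ν = 3 := by
  have key : ∀ a b : Fin 4, a < b →
      (Equiv.swap (2 : Fin 4) a * Equiv.swap 3 b) a = 2 ∧
        (Equiv.swap (2 : Fin 4) a * Equiv.swap 3 b) b = 3 := by
    decide
  exact key μ ν hμν

/-! ### The covariance step at one orientation -/

/-- **The doubly static gain at orientation `(μ,ν)` from the 2D statement.**  If the static lift
of the plane field `A a b j = U(site a b, π⁻¹ j)` (`π μ = 2`, `π ν = 3`) obeys the doubly static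
gain bound with its `(2,3)`-deficits `dA a b`, then the doubly static field `W = W(μ,ν,y)[U]`
obeys it with the `(μ,ν)`-deficits `G p` of `U` on the plaquettes `p` of the plane through `y`
(same constants, same comparison field `T`): the determinants agree by `lift_plane_eq` and
`det_wilsonDirac_perm`, the exponents by `dfc2_plane_eq` and `plane_reindex`. -/
theorem covariance_core [NeZero L] (hμν : μ < ν) (δ c K C m : ℝ)
    (U : GaugeConfig 4 L (Matrix.specialUnitaryGroup (Fin 3) ℂ))
    (π : Equiv.Perm (Fin 4)) (hπμ : π μ = 2) (hπν : π ν = 3)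
    (hsite : ∀ a b i, site a b i = if i = μ then a else if i = ν then b else y i)
    {A : ZMod L → ZMod L → Fin 4 → Matrix.unitaryGroup (Fin 3) ℂ}
    (hA : ∀ a b j, A a b j = unitaryLift U (site a b, π.symm j))
    (W T : GaugeConfig 4 L (Matrix.unitaryGroup (Fin 3) ℂ))
    (hW : ∀ e, W e = if e.2 = μ ∨ e.2 = ν
      then apLift U (fun i => if i = μ ∨ i = ν then e.1 i else y i, e.2)
      else (if e.1 e.2 = -1 then (-1 : Matrix.unitaryGroup (Fin 3) ℂ) else 1))
    (G : Plaquette 4 L → ℝ)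
    (hG : ∀ p, G p = 3 - (fundamentalRep (Fin 3) (plaquetteHolonomy U p.1 p.2.1.1 p.2.1.2)).trace.re)
    (dA : ZMod L → ZMod L → ℝ)
    (hdA : ∀ a b, dA a b = 3 - ((A a b 2 : Matrix (Fin 3) (Fin 3) ℂ) *
      (A (a + 1) b 3 : Matrix (Fin 3) (Fin 3) ℂ) * star (A a (b + 1) 2 : Matrix (Fin 3) (Fin 3) ℂ) *
      star (A a b 3 : Matrix (Fin 3) (Fin 3) ℂ)).trace.re)
    (h1 : ‖(wilsonDirac (unitaryFundamentalRep (Fin 3) ℂ) (fun e : Edge 4 L =>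
          if e.2 = 0 ∨ e.2 = 1 then (if e.1 e.2 = -1 then (-1 : Matrix.unitaryGroup (Fin 3) ℂ) else 1)
          else (if e.1 e.2 = -1 then -(A (e.1 2) (e.1 3) e.2) else A (e.1 2) (e.1 3) e.2)) m 1).det‖ ≤
      Real.exp (K - c * (L : ℝ) ^ 2 *
          (∑ ab ∈ (Finset.univ : Finset (ZMod L × ZMod L)).filter (fun ab => dA ab.1 ab.2 < δ),
            dA ab.1 ab.2) +
        C * (L : ℝ) ^ 2 *
          (((Finset.univ : Finset (ZMod L × ZMod L)).filter (fun ab => δ ≤ dA ab.1 ab.2)).card : ℝ)) *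
      ‖(wilsonDirac (unitaryFundamentalRep (Fin 3) ℂ) T m 1).det‖) :
    ‖(wilsonDirac (unitaryFundamentalRep (Fin 3) ℂ) W m 1).det‖ ≤
      Real.exp (K - c * (L : ℝ) ^ 2 *
          (∑ p ∈ Finset.univ.filter (fun p : Plaquette 4 L =>
            (p.2.1.1 = μ ∧ p.2.1.2 = ν ∧ ∀ i, i ≠ μ → i ≠ ν → p.1 i = y i) ∧ G p < δ), G p) +
        C * (L : ℝ) ^ 2 *
          ((Finset.univ.filter (fun p : Plaquette 4 L =>
            (p.2.1.1 = μ ∧ p.2.1.2 = ν ∧ ∀ i, i ≠ μ → i ≠ ν → p.1 i = y i) ∧ δ ≤ G p)).card : ℝ)) *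
      ‖(wilsonDirac (unitaryFundamentalRep (Fin 3) ℂ) T m 1).det‖ := by
  have key : ∀ (x x' S S' : ℝ) (N N' : ℕ) (z : ℝ), x = x' → S = S' → N = N' →
      x' ≤ Real.exp (K - c * (L : ℝ) ^ 2 * S' + C * (L : ℝ) ^ 2 * (N' : ℝ)) * z →
      x ≤ Real.exp (K - c * (L : ℝ) ^ 2 * S + C * (L : ℝ) ^ 2 * (N : ℝ)) * z := by
    rintro x x' S S' N N' z rfl rfl rfl h
    exact h
  have hfg : ∀ ab : ZMod L × ZMod L, dA ab.1 ab.2 = G (site ab.1 ab.2, ⟨(μ, ν), hμν⟩) := fun ab =>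
    (hdA ab.1 ab.2).trans ((dfc2_plane_eq U hμν π hπμ hπν hsite hA ab.1 ab.2).trans
      (hG (site ab.1 ab.2, ⟨(μ, ν), hμν⟩)).symm)
  refine key _ _ _ _ _ _ _ ?_ ?_ ?_ h1
  · rw [lift_plane_eq U hμν π hπμ hπν hsite hA hW]
    exact congrArg (fun z : ℂ => ‖z‖) (det_wilsonDirac_perm π W m).symm
  · exact (plane_reindex hμν hsite G (fun ab => dA ab.1 ab.2) hfg (· < δ) _ _
      (fun p => Finset.mem_filter_univ p) (fun ab => Finset.mem_filter_univ ab)).1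
  · exact (plane_reindex hμν hsite G (fun ab => dA ab.1 ab.2) hfg (δ ≤ ·) _ _
      (fun p => Finset.mem_filter_univ p) (fun ab => Finset.mem_filter_univ ab)).2

end StaticCovariance

/-! ### The stub -/

/-- **S0 `stub_staticCovariance`** — from the 2D statement for the gain orientation `(2,3)` to
every orientation `(μ,ν)` of the crux field: read the 2D field off the `(μ,ν)`-plane through `y`
and transport by the hypercubic covariance of the Wilson determinant
(`AxisSwap.det_wilsonDirac_swap`, extended to every coordinate permutation in
`StaticCovariance.det_wilsonDirac_perm`) and of plaquette deficits
(`StaticCovariance.dfc2_plane_eq`, `StaticCovariance.plane_reindex`), with the permutation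
`(2 μ)(3 ν)` (`StaticCovariance.covariance_core`). -/
theorem stub_staticCovariance : (∃ ε δ c K C : ℝ, 0 < ε ∧ 0 < δ ∧ 0 < c ∧ ∃ L₀ : ℕ, ∀ (L : ℕ) [NeZero L], Odd L → L₀ ≤ L →
      ∀ (A : ZMod L → ZMod L → Fin 4 → Matrix.unitaryGroup (Fin 3) ℂ) (m : ℝ), |m| ≤ ε →
      let lift := fun (A : ZMod L → ZMod L → Fin 4 → Matrix.unitaryGroup (Fin 3) ℂ) (e : Edge 4 L) =>
        if e.2 = 0 ∨ e.2 = 1 then (if e.1 e.2 = -1 then (-1 : Matrix.unitaryGroup (Fin 3) ℂ) else 1)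
        else (if e.1 e.2 = -1 then -(A (e.1 2) (e.1 3) e.2) else A (e.1 2) (e.1 3) e.2);
      let T := fun e : Edge 4 L => if e.1 e.2 = -1 then (-1 : Matrix.unitaryGroup (Fin 3) ℂ) else 1;
      let dfc2 := fun (A : ZMod L → ZMod L → Fin 4 → Matrix.unitaryGroup (Fin 3) ℂ) (a b : ZMod L) =>
        3 - ((A a b 2 : Matrix (Fin 3) (Fin 3) ℂ) * (A (a + 1) b 3 : Matrix (Fin 3) (Fin 3) ℂ) *
          star (A a (b + 1) 2 : Matrix (Fin 3) (Fin 3) ℂ) * star (A a b 3 : Matrix (Fin 3) (Fin 3) ℂ)).trace.re;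
      ‖(wilsonDirac (unitaryFundamentalRep (Fin 3) ℂ) (lift A) m 1).det‖ ≤
        Real.exp (K - c * (L : ℝ) ^ 2 * (∑ ab ∈ (Finset.univ : Finset (ZMod L × ZMod L)).filter (fun ab => dfc2 A ab.1 ab.2 < δ), dfc2 A ab.1 ab.2)
          + C * (L : ℝ) ^ 2 * (((Finset.univ : Finset (ZMod L × ZMod L)).filter (fun ab => δ ≤ dfc2 A ab.1 ab.2)).card : ℝ)) *
        ‖(wilsonDirac (unitaryFundamentalRep (Fin 3) ℂ) T m 1).det‖) →
    ∃ ε δ c K C : ℝ, 0 < ε ∧ 0 < δ ∧ 0 < c ∧ ∃ L₀ : ℕ, ∀ (L : ℕ) [NeZero L], Odd L → L₀ ≤ L →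
    ∀ (m : ℝ), |m| ≤ ε → ∀ (U : GaugeConfig 4 L (Matrix.specialUnitaryGroup (Fin 3) ℂ)) (μ ν : Fin 4), μ < ν → ∀ (y : Site 4 L),
    let V : GaugeConfig 4 L (Matrix.unitaryGroup (Fin 3) ℂ) := fun e =>
      if e.1 e.2 = -1 then -(⟨(U e).1, Matrix.specialUnitaryGroup_le_unitaryGroup (U e).2⟩ : Matrix.unitaryGroup (Fin 3) ℂ)
      else ⟨(U e).1, Matrix.specialUnitaryGroup_le_unitaryGroup (U e).2⟩;
    let W : GaugeConfig 4 L (Matrix.unitaryGroup (Fin 3) ℂ) := fun e =>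
      if e.2 = μ ∨ e.2 = ν then V (fun i => if i = μ ∨ i = ν then e.1 i else y i, e.2)
      else (if e.1 e.2 = -1 then (-1 : Matrix.unitaryGroup (Fin 3) ℂ) else 1);
    let T := fun e : Edge 4 L => if e.1 e.2 = -1 then (-1 : Matrix.unitaryGroup (Fin 3) ℂ) else 1;
    let dfc : GaugeConfig 4 L (Matrix.specialUnitaryGroup (Fin 3) ℂ) → Plaquette 4 L → ℝ := fun U p =>
      3 - (fundamentalRep (Fin 3) (plaquetteHolonomy U p.1 p.2.1.1 p.2.1.2)).trace.re;
    let inPlane : Plaquette 4 L → Prop := fun p => p.2.1.1 = μ ∧ p.2.1.2 = ν ∧ ∀ i, i ≠ μ → i ≠ ν → p.1 i = y i;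
    ‖(wilsonDirac (unitaryFundamentalRep (Fin 3) ℂ) W m 1).det‖ ≤
      Real.exp (K - c * (L : ℝ) ^ 2 * (∑ p ∈ Finset.univ.filter (fun p => inPlane p ∧ dfc U p < δ), dfc U p)
        + C * (L : ℝ) ^ 2 * ((Finset.univ.filter (fun p => inPlane p ∧ δ ≤ dfc U p)).card : ℝ)) *
      ‖(wilsonDirac (unitaryFundamentalRep (Fin 3) ℂ) T m 1).det‖ := by
  rintro ⟨ε, δ, c, K, C, hε, hδ, hc, L₀, h⟩
  refine ⟨ε, δ, c, K, C, hε, hδ, hc, L₀, ?_⟩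
  intro L _ hodd hL m hm U μ ν hμν y V W T dfc inPlane
  obtain ⟨π, hπμ, hπν⟩ : ∃ π : Equiv.Perm (Fin 4), π μ = 2 ∧ π ν = 3 :=
    ⟨_, StaticCovariance.swap_pair_apply hμν⟩
  obtain ⟨site, hsite⟩ : ∃ site : ZMod L → ZMod L → Site 4 L,
      ∀ a b i, site a b i = if i = μ then a else if i = ν then b else y i :=
    ⟨_, fun _ _ _ => rfl⟩
  obtain ⟨A, hA⟩ : ∃ A : ZMod L → ZMod L → Fin 4 → Matrix.unitaryGroup (Fin 3) ℂ,
      ∀ a b j, A a b j = unitaryLift U (site a b, π.symm j) :=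
    ⟨_, fun _ _ _ => rfl⟩
  exact StaticCovariance.covariance_core hμν δ c K C m U π hπμ hπν hsite hA W T (fun _ => rfl)
    (dfc U) (fun _ => rfl)
    (fun a b => 3 - ((A a b 2 : Matrix (Fin 3) (Fin 3) ℂ) * (A (a + 1) b 3 : Matrix (Fin 3) (Fin 3) ℂ) *
      star (A a (b + 1) 2 : Matrix (Fin 3) (Fin 3) ℂ) * star (A a b 3 : Matrix (Fin 3) (Fin 3) ℂ)).trace.re)
    (fun _ _ => rfl) (h L hodd hL A m hm)

end Summit.QuantumFields.QCD.Cruxes.CriticalLineDiamagnetism.ChessboardCellGain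

end
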